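import Summits.BirchSwinnertonDyer.BirchSwinnertonDyer.Theorems.TwoAdicConverseGoodTwistsKolyvaginBigImageLeaf
import Literature.NumberTheory.EllipticCurves.VariableChangePoints
import HarnessLib

/-!
# Route TwoAdicConverse — the S3 head line (rank BSD for `100 %` of good twists + Goldfeld `50/50`)
# for every curve of a TWIST-CLOSED class, from the leaf RESTRICTED to that class (generic engine;
# proofs only)

Cell `bsd-2adic`, seat `bsd-2adic-conv-1` GEN 18 (`--supports` item stmt-BirchSwinnertonDyer-19218; nothing
here closes it).  The cell derives LADDER-BSD §1 row S3's head line — for a globally minimal non-CM `W/ℚ`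
good-ordinary or multiplicative at `2`: `ord_{s=1} L(W^{(d)}, s) = rank W^{(d)}(ℚ)` and `Ш(W^{(d)}/ℚ)`
finite for `100 %` of the good twists `d ∈ 𝓕 = {d square-free, d ≡ 1 (mod 4)}`, and Goldfeld's `50/50`
with BSD in `𝓕` — from a `2`-CONVERSE for every good twist of `W` plus GZK, Modularity and Smith's Thm 1.1
(`TwoAdicGoodTwists.bsdRank_and_goldfeld_goodTwists_of_nonCMTwoConverse[_leaf]`: the whole leaf;
`TwoAdicKolyvaginGoodTwists.…_leafHabitat_of_kolyvaginAtTwo`: the big-image habitat, which is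
twist-closed).  This file proves the statement ONCE for an ARBITRARY predicate `P` on Weierstrass equations
that is stable under "minimal model of a quadratic twist" (`C • W' = W^{(d)} ⟹ (P W → P W')`):

* `bsdRank_quadraticTwist_of_selmerCorankTwoInfty_le_one_of_leafOn` — one good twist: the leaf
  RESTRICTED TO `P` (`∀ V, ¬CM → GoodOrd ∨ Mult at 2 → P V → ∀ r ≤ 1, corank₂ = r → r_an = r`) gives
  rank BSD for `W^{(d)}` whenever `P W`, `d ≡ 1 (mod 4)` and `corank Sel_{2^∞}(W^{(d)}) ≤ 1`;
* `twistDensity_bsdRank_of_leafOn`, `tendsto_bsdRank[_eq_selmerCorankTwoInfty]_of_leafOn`,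
  `tendsto_familyProportion_rank{Zero,One}_of_leafOn`, `bsdRank_and_goldfeld_goodTwists_of_leafOn` — the
  head line for every `W` with `P W`, from the `P`-restricted leaf + GZK + Modularity + Smith.

Transport lemmas for the predicates of the OFF-habitat strata (companion file
`TwoAdicConverseGoodTwistsOffHabitat`): `exists_two_torsion_smul_iff` (rational `2`-torsion is
model-independent: the point-group isomorphism `VariableChange.pointEquiv`), `isSquare_Δ_smul_iff` /
`isSquare_neg_Δ_smul_iff` (`Δ(C • W) = u⁻¹²Δ(W)`).

HONEST FRAMING.  Pure logic + counting already in the tree; the `P`-restricted leaf, GZK, Modularity and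
Smith's theorem are hypotheses; no item is filed (D-0014); nothing is booked (D-0054); BSD is not proved
by any of this.  PARTITION: none — RANK axis (S3); companion cell X5@2.

References: A. Smith, arXiv:2503.17619, Thm 1.1 / Cor 1.2 [arXiv250317619]; M. R. Murty, V. K. Murty,
*Non-vanishing of L-functions and applications* (1997) Ch. 6 §1 [MurtyMurty1997]; J. H. Silverman, AEC
(2009) III.3.1(b), X.5 Cor 5.4 [SilvermanAEC2009].
-/

set_option linter.dupNamespace false
set_option autoImplicit false

noncomputable section

open scoped Classical
open Filter Topology WeierstrassCurve Literature Literature.NumberTheory.EllipticCurves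
  Literature.NumberTheory.EllipticCurves.ModularForms
  Literature.NumberTheory.EllipticCurves.Rank1Residual
  Summit.BirchSwinnertonDyer.BirchSwinnertonDyer.Theses.TwoAdicConverse
  Summit.BirchSwinnertonDyer.BirchSwinnertonDyer.Theorems.GoldfeldGoodTwists
  Summit.BirchSwinnertonDyer.BirchSwinnertonDyer.Theorems.TwoAdicGoodTwists
  Summit.BirchSwinnertonDyer.BirchSwinnertonDyer.Theorems.TwoAdicKolyvaginGoodTwists

namespace Summit.BirchSwinnertonDyer.BirchSwinnertonDyer.Theorems.TwoAdicOffHabitat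

/-! ## §0 Model-independence of the stratum data -/

/-- **A rational point of exact order `2` is model-independent**: `C • W` has one iff `W` has
(`VariableChange.pointEquiv W C : W(ℚ) ≃+ (C • W)(ℚ)`). [cite: SilvermanAEC2009, III.3.1(b) and proof of III.2.5] -/
theorem exists_two_torsion_smul_iff (W : WeierstrassCurve ℚ) (C : VariableChange ℚ) :
    (∃ P : (C • W).toAffine.Point, P ≠ 0 ∧ 2 • P = 0) ↔ ∃ P : W.toAffine.Point, P ≠ 0 ∧ 2 • P = 0 := by
  set e := VariableChange.pointEquiv W C with he
  constructor
  · rintro ⟨P, hP0, h2P⟩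
    refine ⟨e.symm P, (map_ne_zero_iff e.symm e.symm.injective).mpr hP0, ?_⟩
    rw [← map_nsmul, h2P, map_zero]
  · rintro ⟨P, hP0, h2P⟩
    refine ⟨e P, (map_ne_zero_iff e e.injective).mpr hP0, ?_⟩
    rw [← map_nsmul, h2P, map_zero]

/-- **`Δ ∈ ℚ^{×2}` is model-independent** (`Δ(C • W) = u⁻¹² Δ(W) = (u⁻⁶)² Δ(W)`).
[cite: SilvermanAEC2009, III.1 Table 3.1] -/
theorem isSquare_Δ_smul_iff (W : WeierstrassCurve ℚ) (C : VariableChange ℚ) :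
    IsSquare (C • W).Δ ↔ IsSquare W.Δ := by
  rw [variableChange_Δ]
  constructor
  · rintro ⟨s, hs⟩
    refine ⟨s * (C.u : ℚ) ^ 6, ?_⟩
    have hu : ((C.u⁻¹ : ℚˣ) : ℚ) * (C.u : ℚ) = 1 := by simp
    have : W.Δ = ((C.u⁻¹ : ℚˣ) : ℚ) ^ 12 * W.Δ * (C.u : ℚ) ^ 12 := by
      rw [mul_comm (((C.u⁻¹ : ℚˣ) : ℚ) ^ 12), mul_assoc, ← mul_pow, hu, one_pow, mul_one]
    rw [this, hs]
    ring
  · rintro ⟨r, hr⟩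
    exact ⟨((C.u⁻¹ : ℚˣ) : ℚ) ^ 6 * r, by rw [hr]; ring⟩

/-- **`-Δ ∈ ℚ^{×2}` is model-independent.** [cite: SilvermanAEC2009, III.1 Table 3.1] -/
theorem isSquare_neg_Δ_smul_iff (W : WeierstrassCurve ℚ) (C : VariableChange ℚ) :
    IsSquare (-(C • W).Δ) ↔ IsSquare (-W.Δ) := by
  rw [variableChange_Δ]
  constructor
  · rintro ⟨s, hs⟩
    refine ⟨s * (C.u : ℚ) ^ 6, ?_⟩
    have hu : ((C.u⁻¹ : ℚˣ) : ℚ) * (C.u : ℚ) = 1 := by simp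
    have : -W.Δ = -(((C.u⁻¹ : ℚˣ) : ℚ) ^ 12 * W.Δ) * (C.u : ℚ) ^ 12 := by
      rw [mul_comm (((C.u⁻¹ : ℚˣ) : ℚ) ^ 12), neg_mul, mul_assoc, ← mul_pow, hu, one_pow, mul_one]
    rw [this, hs]
    ring
  · rintro ⟨r, hr⟩
    exact ⟨((C.u⁻¹ : ℚˣ) : ℚ) ^ 6 * r, by linear_combination (((C.u⁻¹ : ℚˣ) : ℚ) ^ 12) * hr⟩

/-! ## §1 One good twist of a curve in a twist-closed class: rank BSD at Selmer corank `≤ 1` -/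

section OneTwist

/-- **Rank BSD for one good twist, from the leaf RESTRICTED to a twist-closed class `P`.**  Let `P` be
a predicate on Weierstrass equations over `ℚ` stable under "minimal model of a quadratic twist"
(`hP : C • W' = W^{(d)} ⟹ P W ⟹ P W'`), and suppose the leaf holds ON `P`
(`hleaf : ∀ V, ¬CM → GoodOrd ∨ Mult at 2 → P V → ∀ r ≤ 1, corank₂ = r → r_an = r`).  Then for
`W/ℚ` globally minimal, non-CM, good-ordinary or multiplicative at `2`, with `P W`, `d ≡ 1 (mod 4)` and
`r := corank_{ℤ₂} Sel_{2^∞}(W^{(d)}) ≤ 1`: `ord_{s=1} L(W^{(d)}, s) = rank W^{(d)}(ℚ) = r` and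
`Ш(W^{(d)}/ℚ)` is finite.  (Transport to a minimal model `W'` of `W^{(d)}` — non-CM and of the same type
at `2` by `not_hasCM_and_goodOrd_or_mult_of_smul_eq_quadraticTwist`, in `P` by `hP` — apply `hleaf`,
come back with `analyticRank_smul` / `selmerCorank_eq_of_variableChange`, and GZK.)
[cite: arXiv250317619, §1 (the p-converse input of Cor. 1.2)] [cite: SilvermanAEC2009, X.5 Cor. 5.4] -/
theorem bsdRank_quadraticTwist_of_selmerCorankTwoInfty_le_one_of_leafOn
    (P : WeierstrassCurve ℚ → Prop)
    (hP : ∀ (V V' : WeierstrassCurve ℚ) [V.IsElliptic] {d : ℚ}, d ≠ 0 → ∀ {C : VariableChange ℚ},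
      C • V' = V.quadraticTwist d → P V → P V')
    (hleaf : ∀ (V : WeierstrassCurve ℚ) [V.IsElliptic] [V.IsGloballyMinimal], ¬ V.HasCM →
      (GoodOrd V 2 ∨ Mult V 2) → P V → ∀ r : ℕ, r ≤ 1 → V.selmerCorank 2 = r → V.analyticRank = r)
    (hGZK : rank_eq_analyticRank_of_analyticRank_le_one)
    (W : WeierstrassCurve ℚ) [W.IsElliptic] [W.IsGloballyMinimal] (hCM : ¬ W.HasCM)
    (hred : GoodOrd W 2 ∨ Mult W 2) (hW : P W)
    {d : ℤ} (hd4 : d % 4 = 1) (hle : selmerCorankTwoInfty (W.quadraticTwist d) ≤ 1) :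
    (W.quadraticTwist d).analyticRank = selmerCorankTwoInfty (W.quadraticTwist d) ∧
      (W.quadraticTwist d).mordellWeilRank = selmerCorankTwoInfty (W.quadraticTwist d) ∧
        Finite (W.quadraticTwist d).sha := by
  have hd0 : ((d : ℤ) : ℚ) ≠ 0 := by exact_mod_cast (show d ≠ 0 by omega)
  haveI := W.isElliptic_quadraticTwist hd0
  obtain ⟨W', hW'ell, hW'min, C, hC⟩ := exists_isGloballyMinimal_smul_eq_quadraticTwist W hd0
  obtain ⟨hCM', hred'⟩ := not_hasCM_and_goodOrd_or_mult_of_smul_eq_quadraticTwist W W' hCM hred hd4 hC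
  have hW' : P W' := hP W W' hd0 hC hW
  have hcor' : W'.selmerCorank 2 = selmerCorankTwoInfty (W.quadraticTwist d) := by
    rw [selmerCorank_eq_of_variableChange 2 hC, ← selmerCorankTwoInfty_eq]
  have hW'r : W'.analyticRank = selmerCorankTwoInfty (W.quadraticTwist d) :=
    hleaf W' hCM' hred' hW' _ hle hcor'
  have har : (W.quadraticTwist (d : ℚ)).analyticRank = selmerCorankTwoInfty (W.quadraticTwist d) := by
    rw [← hW'r, ← hC, analyticRank_smul]
  obtain ⟨hrank, hsha⟩ := hGZK (W.quadraticTwist (d : ℚ)) (by omega)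
  exact ⟨har, by rw [hrank, har], hsha⟩

end OneTwist

/-! ## §2 The head line for every curve of a twist-closed class, from the leaf on that class -/

section Density

variable (P : WeierstrassCurve ℚ → Prop)
  (hP : ∀ (V V' : WeierstrassCurve ℚ) [V.IsElliptic] {d : ℚ}, d ≠ 0 → ∀ {C : VariableChange ℚ},
    C • V' = V.quadraticTwist d → P V → P V')
  (hleaf : ∀ (V : WeierstrassCurve ℚ) [V.IsElliptic] [V.IsGloballyMinimal], ¬ V.HasCM →
    (GoodOrd V 2 ∨ Mult V 2) → P V → ∀ r : ℕ, r ≤ 1 → V.selmerCorank 2 = r → V.analyticRank = r)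
  (hGZK : rank_eq_analyticRank_of_analyticRank_le_one)
  (W : WeierstrassCurve ℚ) [W.IsElliptic] [W.IsGloballyMinimal]

include hP hleaf hGZK

/-- **Rank BSD for `100 %` of all square-free `d` with `d ≡ 1 (mod 4)`** (Smith's normalisation), for
`W` in the twist-closed class `P`, from the `P`-restricted leaf, GZK and Smith's Thm 1.1 for `W`.
[cite: arXiv250317619, Thm. 1.1 and Cor. 1.2] -/
theorem twistDensity_bsdRank_of_leafOn (hCM : ¬ W.HasCM) (hred : GoodOrd W 2 ∨ Mult W 2) (hW : P W)
    (hS : smith_selmerCorank_density W) :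
    twistDensity (fun d ↦ d % 4 = 1 →
      (W.quadraticTwist d).analyticRank = (W.quadraticTwist d).mordellWeilRank ∧
        Finite (W.quadraticTwist d).sha) 1 := by
  refine twistDensity_one_mono (fun d _ hRd hd4 ↦ ?_) (twistDensity_selmerCorankTwoInfty_le_one_of W hS)
  obtain ⟨har, hrank, hsha⟩ := bsdRank_quadraticTwist_of_selmerCorankTwoInfty_le_one_of_leafOn P hP hleaf
    hGZK W hCM hred hW hd4 hRd.2
  exact ⟨har.trans hrank.symm, hsha⟩

/-- **For `100 %` of `d ∈ 𝓕`: `ord L = rank = corank Sel_{2^∞} ≤ 1` and `Ш` finite**, for `W` in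
the twist-closed class `P`. [cite: arXiv250317619, Thm. 1.1 and Cor. 1.2] -/
theorem tendsto_bsdRank_eq_selmerCorankTwoInfty_of_leafOn (hCM : ¬ W.HasCM)
    (hred : GoodOrd W 2 ∨ Mult W 2) (hW : P W) (hS : smith_selmerCorank_density W) :
    Tendsto (fun X : ℕ ↦ (Nat.card {d : ℤ | Squarefree d ∧ |d| ≤ (X : ℤ) ∧ (d % 4 = 1 ∧
        (selmerCorankTwoInfty (W.quadraticTwist d) ≤ 1 ∧
          (W.quadraticTwist d).analyticRank = selmerCorankTwoInfty (W.quadraticTwist d) ∧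
          (W.quadraticTwist d).mordellWeilRank = selmerCorankTwoInfty (W.quadraticTwist d) ∧
          Finite (W.quadraticTwist d).sha))} : ℝ) /
      Nat.card {d : ℤ | Squarefree d ∧ |d| ≤ (X : ℤ) ∧ d % 4 = 1}) atTop (𝓝 1) := by
  have hR := twistDensity_selmerCorankTwoInfty_le_one_of W hS
  have h0 : twistDensity (fun d ↦ ¬ (d ≠ 0 ∧ selmerCorankTwoInfty (W.quadraticTwist d) ≤ 1)) 0 := by
    simpa using hR.compl
  refine tendsto_familyProportion_one_of_twistDensity_zero (h0.mono_zero fun d _ h hRd ↦ h.2 ?_)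
  exact ⟨hRd.2, bsdRank_quadraticTwist_of_selmerCorankTwoInfty_le_one_of_leafOn P hP hleaf hGZK W hCM
    hred hW h.1 hRd.2⟩

/-- **The head line's first clause: rank BSD for `100 %` of `d ∈ 𝓕`**, for `W` in the twist-closed class
`P`. [cite: arXiv250317619, Thm. 1.1 and Cor. 1.2] -/
theorem tendsto_bsdRank_of_leafOn (hCM : ¬ W.HasCM) (hred : GoodOrd W 2 ∨ Mult W 2) (hW : P W)
    (hS : smith_selmerCorank_density W) :
    Tendsto (fun X : ℕ ↦ (Nat.card {d : ℤ | Squarefree d ∧ |d| ≤ (X : ℤ) ∧ (d % 4 = 1 ∧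
        ((W.quadraticTwist d).analyticRank = (W.quadraticTwist d).mordellWeilRank ∧
          Finite (W.quadraticTwist d).sha))} : ℝ) /
      Nat.card {d : ℤ | Squarefree d ∧ |d| ≤ (X : ℤ) ∧ d % 4 = 1}) atTop (𝓝 1) := by
  have hR := twistDensity_selmerCorankTwoInfty_le_one_of W hS
  have h0 : twistDensity (fun d ↦ ¬ (d ≠ 0 ∧ selmerCorankTwoInfty (W.quadraticTwist d) ≤ 1)) 0 := by
    simpa using hR.compl
  refine tendsto_familyProportion_one_of_twistDensity_zero (h0.mono_zero fun d _ h hRd ↦ h.2 ?_)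
  obtain ⟨har, hrank, hsha⟩ := bsdRank_quadraticTwist_of_selmerCorankTwoInfty_le_one_of_leafOn P hP
    hleaf hGZK W hCM hred hW h.1 hRd.2
  exact ⟨har.trans hrank.symm, hsha⟩

/-- **Goldfeld's odd half with BSD in `𝓕`**, for `W` in the twist-closed class `P` (root numbers
equidistribute in `𝓕`: Modularity `hmod`). [cite: arXiv250317619, Thm. 1.1 and Cor. 1.2] [cite: MurtyMurty1997, Ch. 6 §1] -/
theorem tendsto_familyProportion_rankOne_of_leafOn (hmod : exists_isNewformOf) (hCM : ¬ W.HasCM)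
    (hred : GoodOrd W 2 ∨ Mult W 2) (hW : P W) (hS : smith_selmerCorank_density W) :
    Tendsto (fun X : ℕ ↦ (Nat.card {d : ℤ | Squarefree d ∧ |d| ≤ (X : ℤ) ∧ (d % 4 = 1 ∧
        ((W.quadraticTwist d).analyticRank = 1 ∧ (W.quadraticTwist d).mordellWeilRank = 1 ∧
          Finite (W.quadraticTwist d).sha))} : ℝ) /
      Nat.card {d : ℤ | Squarefree d ∧ |d| ≤ (X : ℤ) ∧ d % 4 = 1}) atTop (𝓝 (1 / 2)) := by
  refine tendsto_familyProportion_of_congr_one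
    (tendsto_familyProportion_rootNumber_eq_neg_one W hmod)
    (tendsto_bsdRank_eq_selmerCorankTwoInfty_of_leafOn P hP hleaf hGZK W hCM hred hW hS)
    fun d hd _ hR ↦ ?_
  obtain ⟨hle, hra, hrk, hsha⟩ := hR
  haveI := W.isElliptic_quadraticTwist (d := (d : ℚ)) (by exact_mod_cast hd.ne_zero)
  rw [rootNumber_eq_neg_one_iff_analyticRank_eq_one hmod _ (hra ▸ hle)]
  constructor
  · intro h1; exact ⟨h1, by rw [hrk, ← hra, h1], hsha⟩
  · exact fun h ↦ h.1

/-- **Goldfeld's even half with BSD in `𝓕`**, for `W` in the twist-closed class `P`.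
[cite: arXiv250317619, Thm. 1.1 and Cor. 1.2] [cite: MurtyMurty1997, Ch. 6 §1] -/
theorem tendsto_familyProportion_rankZero_of_leafOn (hmod : exists_isNewformOf) (hCM : ¬ W.HasCM)
    (hred : GoodOrd W 2 ∨ Mult W 2) (hW : P W) (hS : smith_selmerCorank_density W) :
    Tendsto (fun X : ℕ ↦ (Nat.card {d : ℤ | Squarefree d ∧ |d| ≤ (X : ℤ) ∧ (d % 4 = 1 ∧
        ((W.quadraticTwist d).analyticRank = 0 ∧ (W.quadraticTwist d).mordellWeilRank = 0 ∧
          Finite (W.quadraticTwist d).sha))} : ℝ) /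
      Nat.card {d : ℤ | Squarefree d ∧ |d| ≤ (X : ℤ) ∧ d % 4 = 1}) atTop (𝓝 (1 / 2)) := by
  refine tendsto_familyProportion_of_congr_one (tendsto_familyProportion_rootNumber_eq_one W hmod)
    (tendsto_bsdRank_eq_selmerCorankTwoInfty_of_leafOn P hP hleaf hGZK W hCM hred hW hS)
    fun d hd _ hR ↦ ?_
  obtain ⟨hle, hra, hrk, hsha⟩ := hR
  haveI := W.isElliptic_quadraticTwist (d := (d : ℚ)) (by exact_mod_cast hd.ne_zero)
  rw [rootNumber_eq_one_iff_analyticRank_eq_zero hmod _ (hra ▸ hle)]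
  constructor
  · intro h0; exact ⟨h0, by rw [hrk, ← hra, h0], hsha⟩
  · exact fun h ↦ h.1

/-- **LADDER-BSD §1 row S3's head line for every curve of a TWIST-CLOSED class `P`, from the leaf ON
`P`** — for `W/ℚ` globally minimal, non-CM, good-ordinary or multiplicative at `2`, with `P W`: rank BSD
for `100 %` of `d ∈ 𝓕` and Goldfeld's `50/50` with BSD in `𝓕`, from the `P`-restricted `2`-converse
(`r ≤ 1`) + GZK + Modularity + Smith's Thm 1.1 for `W`.  Instances: `P :=` the big-image habitat
(GEN 17), the off-habitat complement and its strata (companion file).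
[cite: arXiv250317619, Thm. 1.1 and Cor. 1.2] [cite: MurtyMurty1997, Ch. 6 §1] -/
theorem bsdRank_and_goldfeld_goodTwists_of_leafOn (hmod : exists_isNewformOf) (hCM : ¬ W.HasCM)
    (hred : GoodOrd W 2 ∨ Mult W 2) (hW : P W) (hS : smith_selmerCorank_density W) :
    Tendsto (fun X : ℕ ↦ (Nat.card {d : ℤ | Squarefree d ∧ |d| ≤ (X : ℤ) ∧ (d % 4 = 1 ∧
        ((W.quadraticTwist d).analyticRank = (W.quadraticTwist d).mordellWeilRank ∧
          Finite (W.quadraticTwist d).sha))} : ℝ) /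
      Nat.card {d : ℤ | Squarefree d ∧ |d| ≤ (X : ℤ) ∧ d % 4 = 1}) atTop (𝓝 1) ∧
    Tendsto (fun X : ℕ ↦ (Nat.card {d : ℤ | Squarefree d ∧ |d| ≤ (X : ℤ) ∧ (d % 4 = 1 ∧
        ((W.quadraticTwist d).analyticRank = 0 ∧ (W.quadraticTwist d).mordellWeilRank = 0 ∧
          Finite (W.quadraticTwist d).sha))} : ℝ) /
      Nat.card {d : ℤ | Squarefree d ∧ |d| ≤ (X : ℤ) ∧ d % 4 = 1}) atTop (𝓝 (1 / 2)) ∧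
    Tendsto (fun X : ℕ ↦ (Nat.card {d : ℤ | Squarefree d ∧ |d| ≤ (X : ℤ) ∧ (d % 4 = 1 ∧
        ((W.quadraticTwist d).analyticRank = 1 ∧ (W.quadraticTwist d).mordellWeilRank = 1 ∧
          Finite (W.quadraticTwist d).sha))} : ℝ) /
      Nat.card {d : ℤ | Squarefree d ∧ |d| ≤ (X : ℤ) ∧ d % 4 = 1}) atTop (𝓝 (1 / 2)) :=
  ⟨tendsto_bsdRank_of_leafOn P hP hleaf hGZK W hCM hred hW hS,
    tendsto_familyProportion_rankZero_of_leafOn P hP hleaf hGZK W hmod hCM hred hW hS,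
    tendsto_familyProportion_rankOne_of_leafOn P hP hleaf hGZK W hmod hCM hred hW hS⟩

end Density

end Summit.BirchSwinnertonDyer.BirchSwinnertonDyer.Theorems.TwoAdicOffHabitat

end
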